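import Literature.Computability.QuantumComplexity.PauliParseval
import Literature.LinearAlgebra.Matrix.PosSemidefTrace
import HarnessLib

/-!
# The embedded partial trace `reduceTo` and the base case of Lemma 7

Theory of `reduceTo W M` (`PauliExpansion.lean`: the partial trace over the wires outside `W`,
embedded on the block of labels vanishing outside `W`), after Kempe–Regev–Unger–de Wolf,
Quantum Inf. Comput. 10 (2010) 361–376 [KempeEtAl2010], Observation 3 and §3.1.1:

* `reduceTo_eq_sum_conj`: `reduceTo W M = Σ_z E_z M E_zᴴ` (a Kraus form), hence
  `posSemidef_reduceTo`; `trace_reduceTo` (`Tr M_W = Tr M`); linearity;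
* **Observation 3** `pauliCoeff_reduceTo`: `Tr(S M) = Tr(S M_W)` for strings `S` supported in `W`;
* the block Parseval identity and `pauliWeight_eq_card_pow_mul_norm_reduceTo`:
  `Σ_{S ∈ 𝒫^W} |Tr(S M)|² = 2^{|W|} ‖M_W‖²_{HS}` ("or equivalently `Tr(δ_V²) ≤ …`", Lemma 7);
* **the base case of Lemma 7** `pauliWeight_sub_le_of_density`: for density matrices `ρ, τ`
  and every `W`, `Σ_{S ∈ 𝒫^W} |Tr(S(ρ − τ))|² ≤ 2 · 2^{|W|}`
  (§3.1.1: `Tr(δ_V²) = Tr ρ_V² + Tr τ_V² − 2 Tr(ρ_V τ_V) ≤ 2`).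

## References

* [KempeEtAl2010] J. Kempe, O. Regev, F. Unger, R. de Wolf, Quantum Inf. Comput. 10 (2010)
  361–376; arXiv:0802.1464, Observation 3, Lemma 7, §3.1.1.
-/

noncomputable section

open Matrix Finset
open scoped ComplexOrder

namespace Literature.Computability.QuantumComplexity

variable {ι : Type*} [Fintype ι] [DecidableEq ι]

/-! ### Labels split along `W` -/

omit [Fintype ι] in
/-- Projecting a merged label back: on `W`. [folklore] -/
theorem merge_proj_left (W : Finset ι) {x : ι → Bool} (hx : ∀ i, i ∉ W → x i = false) (z : ι → Bool) :
    (fun i => if i ∈ W then (if i ∈ W then x i else z i) else false) = x := by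
  funext i
  by_cases h : i ∈ W
  · simp [h]
  · simp [h, hx i h]

omit [Fintype ι] in
/-- Projecting a merged label back: outside `W`. [folklore] -/
theorem merge_proj_right (W : Finset ι) (x : ι → Bool) {z : ι → Bool} (hz : ∀ i, i ∈ W → z i = false) :
    (fun i => if i ∈ W then false else (if i ∈ W then x i else z i)) = z := by
  funext i
  by_cases h : i ∈ W
  · simp [h, hz i h]
  · simp [h]

omit [Fintype ι] in
/-- Uniqueness of the splitting `y = x ⊕ z` of a label into its `W`-part and its complement part.
[folklore] -/
theorem split_iff (W : Finset ι) (y x z : ι → Bool) :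
    ((∀ i, i ∉ W → x i = false) ∧ (∀ i, i ∈ W → z i = false) ∧
      y = fun i => if i ∈ W then x i else z i) ↔
    (x = fun i => if i ∈ W then y i else false) ∧ (z = fun i => if i ∈ W then false else y i) := by
  constructor
  · rintro ⟨hx, hz, rfl⟩
    exact ⟨(merge_proj_left W hx z).symm, (merge_proj_right W x hz).symm⟩
  · rintro ⟨rfl, rfl⟩
    refine ⟨fun i hi => by simp [hi], fun i hi => by simp [hi], ?_⟩
    funext i
    by_cases h : i ∈ W <;> simp [h]

/-- **Summing over labels through their splitting**: `Σ_y f(y) = Σ_{x ∈ B} Σ_{z ∈ Z} f(x ⊕ z)`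
(`B` = labels vanishing outside `W`, `Z` = labels vanishing on `W`). [folklore] -/
theorem sum_split (W : Finset ι) {β : Type*} [AddCommMonoid β] (f : (ι → Bool) → β) :
    ∑ x : ι → Bool, ∑ z : ι → Bool,
      (if (∀ i, i ∉ W → x i = false) ∧ (∀ i, i ∈ W → z i = false) then
        f (fun i => if i ∈ W then x i else z i) else 0) = ∑ y, f y := by
  have key : ∀ x z : ι → Bool,
      (if (∀ i, i ∉ W → x i = false) ∧ (∀ i, i ∈ W → z i = false) then
        f (fun i => if i ∈ W then x i else z i) else 0) =
      ∑ y, if (x = fun i => if i ∈ W then y i else false) ∧ (z = fun i => if i ∈ W then false else y i)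
        then f y else 0 := by
    intro x z
    by_cases h : (∀ i, i ∉ W → x i = false) ∧ (∀ i, i ∈ W → z i = false)
    · rw [if_pos h, Finset.sum_eq_single (fun i => if i ∈ W then x i else z i)]
      · rw [if_pos ((split_iff W _ x z).1 ⟨h.1, h.2, rfl⟩)]
      · intro y _ hy
        rw [if_neg]
        intro h'
        exact hy ((split_iff W y x z).2 h').2.2
      · exact fun h' => absurd (Finset.mem_univ _) h'
    · rw [if_neg h]
      symm
      refine Finset.sum_eq_zero fun y _ => if_neg fun h' => h ?_
      have := (split_iff W y x z).2 h'
      exact ⟨this.1, this.2.1⟩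
  simp only [key]
  calc ∑ x : ι → Bool, ∑ z : ι → Bool, ∑ y : ι → Bool,
        (if (x = fun i => if i ∈ W then y i else false) ∧ (z = fun i => if i ∈ W then false else y i)
          then f y else 0)
      = ∑ x : ι → Bool, ∑ y : ι → Bool, ∑ z : ι → Bool,
        (if (x = fun i => if i ∈ W then y i else false) ∧ (z = fun i => if i ∈ W then false else y i)
          then f y else 0) := Finset.sum_congr rfl fun x _ => Finset.sum_comm
    _ = ∑ y : ι → Bool, ∑ x : ι → Bool, ∑ z : ι → Bool,
        (if (x = fun i => if i ∈ W then y i else false) ∧ (z = fun i => if i ∈ W then false else y i)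
          then f y else 0) := Finset.sum_comm
    _ = ∑ y, f y := by
        refine Finset.sum_congr rfl fun y _ => ?_
        rw [Finset.sum_comm]
        simp only [ite_and, Finset.sum_ite_eq', Finset.mem_univ, if_true]

/-! ### `reduceTo` as a Kraus map; positivity, trace, linearity -/

/-- `reduceTo` is additive. [folklore] -/
theorem reduceTo_add (W : Finset ι) (M N : Matrix (ι → Bool) (ι → Bool) ℂ) :
    reduceTo W (M + N) = reduceTo W M + reduceTo W N := by
  ext x y
  simp only [reduceTo_apply, Matrix.add_apply, ← Finset.sum_add_distrib]
  refine Finset.sum_congr rfl fun z _ => ?_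
  split_ifs <;> simp

/-- `reduceTo` commutes with negation. [folklore] -/
theorem reduceTo_neg (W : Finset ι) (M : Matrix (ι → Bool) (ι → Bool) ℂ) :
    reduceTo W (-M) = -reduceTo W M := by
  ext x y
  simp only [reduceTo_apply, Matrix.neg_apply, ← Finset.sum_neg_distrib]
  refine Finset.sum_congr rfl fun z _ => ?_
  split_ifs <;> simp

/-- `reduceTo` of a difference. [folklore] -/
theorem reduceTo_sub (W : Finset ι) (M N : Matrix (ι → Bool) (ι → Bool) ℂ) :
    reduceTo W (M - N) = reduceTo W M - reduceTo W N := by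
  rw [sub_eq_add_neg, reduceTo_add, reduceTo_neg, ← sub_eq_add_neg]

/-- The row-selection matrix `E_z = Σ_{x ∈ B} |x⟩⟨x ⊕ z|` applied on the left.
[folklore] -/
theorem selectRows_mul_apply (W : Finset ι) (z : ι → Bool) (M : Matrix (ι → Bool) (ι → Bool) ℂ)
    (x b : ι → Bool) :
    ((Matrix.of fun x a : ι → Bool => if (∀ i, i ∉ W → x i = false) ∧ (∀ i, i ∈ W → z i = false) ∧
        a = (fun i => if i ∈ W then x i else z i) then (1 : ℂ) else 0) * M) x b =
      if (∀ i, i ∉ W → x i = false) ∧ (∀ i, i ∈ W → z i = false) then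
        M (fun i => if i ∈ W then x i else z i) b else 0 := by
  rw [Matrix.mul_apply]
  simp only [Matrix.of_apply, ite_mul, one_mul, zero_mul]
  by_cases h : (∀ i, i ∉ W → x i = false) ∧ (∀ i, i ∈ W → z i = false)
  · rw [if_pos h, Finset.sum_eq_single (fun i => if i ∈ W then x i else z i)]
    · rw [if_pos ⟨h.1, h.2, rfl⟩]
    · intro a _ ha
      exact if_neg fun h' => ha h'.2.2
    · exact fun h' => absurd (Finset.mem_univ _) h'
  · rw [if_neg h]
    exact Finset.sum_eq_zero fun a _ => if_neg fun h' => h ⟨h'.1, h'.2.1⟩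

/-- The conjugate transpose of a `0/1` selection matrix. [folklore] -/
theorem conjTranspose_selectRows (W : Finset ι) (z : ι → Bool) :
    (Matrix.of fun x a : ι → Bool => if (∀ i, i ∉ W → x i = false) ∧ (∀ i, i ∈ W → z i = false) ∧
        a = (fun i => if i ∈ W then x i else z i) then (1 : ℂ) else 0)ᴴ =
      Matrix.of fun a x : ι → Bool => if (∀ i, i ∉ W → x i = false) ∧ (∀ i, i ∈ W → z i = false) ∧
        a = (fun i => if i ∈ W then x i else z i) then (1 : ℂ) else 0 := by
  ext a x
  simp only [Matrix.conjTranspose_apply, Matrix.of_apply]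
  split_ifs <;> simp

/-- **Kraus form of the partial trace**: `reduceTo W M = Σ_z E_z M E_zᴴ` with
`E_z = Σ_{x ∈ B} |x⟩⟨x ⊕ z|` (and `E_z = 0` unless `z` vanishes on `W`). [folklore] -/
theorem reduceTo_eq_sum_conj (W : Finset ι) (M : Matrix (ι → Bool) (ι → Bool) ℂ) :
    reduceTo W M = ∑ z : ι → Bool,
      (Matrix.of fun x a : ι → Bool => if (∀ i, i ∉ W → x i = false) ∧ (∀ i, i ∈ W → z i = false) ∧
        a = (fun i => if i ∈ W then x i else z i) then (1 : ℂ) else 0) * M *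
      (Matrix.of fun x a : ι → Bool => if (∀ i, i ∉ W → x i = false) ∧ (∀ i, i ∈ W → z i = false) ∧
        a = (fun i => if i ∈ W then x i else z i) then (1 : ℂ) else 0)ᴴ := by
  ext x y
  rw [reduceTo_apply, Matrix.sum_apply]
  refine Finset.sum_congr rfl fun z _ => ?_
  rw [conjTranspose_selectRows, Matrix.mul_apply]
  simp only [selectRows_mul_apply, Matrix.of_apply, mul_ite, mul_one, mul_zero]
  by_cases hyz : (∀ i, i ∉ W → y i = false) ∧ (∀ i, i ∈ W → z i = false)
  · rw [Finset.sum_eq_single (fun i => if i ∈ W then y i else z i)]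
    · rw [if_pos (show (∀ i, i ∉ W → y i = false) ∧ (∀ i, i ∈ W → z i = false) ∧
        ((fun i => if i ∈ W then y i else z i) = fun i => if i ∈ W then y i else z i) from
        ⟨hyz.1, hyz.2, rfl⟩)]
      by_cases hx : (∀ i, i ∉ W → x i = false)
      · rw [if_pos (show (∀ i, i ∉ W → x i = false) ∧ (∀ i, i ∉ W → y i = false) ∧
          (∀ i, i ∈ W → z i = false) from ⟨hx, hyz.1, hyz.2⟩),
          if_pos (show (∀ i, i ∉ W → x i = false) ∧ (∀ i, i ∈ W → z i = false) from ⟨hx, hyz.2⟩)]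
      · rw [if_neg (show ¬ ((∀ i, i ∉ W → x i = false) ∧ (∀ i, i ∉ W → y i = false) ∧
          (∀ i, i ∈ W → z i = false)) from fun h => hx h.1),
          if_neg (show ¬ ((∀ i, i ∉ W → x i = false) ∧ (∀ i, i ∈ W → z i = false)) from fun h => hx h.1)]
    · intro b _ hb
      exact if_neg fun h' => hb h'.2.2
    · exact fun h' => absurd (Finset.mem_univ _) h'
  · rw [if_neg (show ¬ ((∀ i, i ∉ W → x i = false) ∧ (∀ i, i ∉ W → y i = false) ∧
      (∀ i, i ∈ W → z i = false)) from fun h => hyz ⟨h.2.1, h.2.2⟩)]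
    exact (Finset.sum_eq_zero fun b _ => if_neg fun h' => hyz ⟨h'.1, h'.2.1⟩).symm

/-- The partial trace of a positive semidefinite matrix is positive semidefinite.
[cite: KempeEtAl2010, §3.1.1 (ρ_V, τ_V are density matrices)] -/
theorem posSemidef_reduceTo (W : Finset ι) {M : Matrix (ι → Bool) (ι → Bool) ℂ} (hM : M.PosSemidef) :
    (reduceTo W M).PosSemidef := by
  rw [reduceTo_eq_sum_conj]
  exact posSemidef_sum _ fun z _ => hM.mul_mul_conjTranspose_same _

/-- The partial trace preserves the trace. [cite: KempeEtAl2010, §3.1.1] -/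
theorem trace_reduceTo (W : Finset ι) (M : Matrix (ι → Bool) (ι → Bool) ℂ) :
    (reduceTo W M).trace = M.trace := by
  simp only [Matrix.trace, Matrix.diag_apply, reduceTo_apply]
  rw [← sum_split W (fun y => M y y)]
  refine Finset.sum_congr rfl fun x _ => Finset.sum_congr rfl fun z _ => ?_
  by_cases h : (∀ i, i ∉ W → x i = false) ∧ (∀ i, i ∈ W → z i = false)
  · rw [if_pos ⟨h.1, h.1, h.2⟩, if_pos h]
  · rw [if_neg (fun h' => h ⟨h'.1, h'.2.2⟩), if_neg h]

/-- `reduceTo W M` vanishes off the block of labels vanishing outside `W`. [folklore] -/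
theorem reduceTo_apply_of_not (W : Finset ι) (M : Matrix (ι → Bool) (ι → Bool) ℂ) {x y : ι → Bool}
    (h : ¬ ((∀ i, i ∉ W → x i = false) ∧ (∀ i, i ∉ W → y i = false))) : reduceTo W M x y = 0 := by
  rw [reduceTo_apply]
  exact Finset.sum_eq_zero fun z _ => if_neg fun h' => h ⟨h'.1, h'.2.1⟩

/-! ### Observation 3: coefficients of strings on `W` only see `M_W` -/

/-- Entries of a string supported in `W` at split labels: for `x, b` vanishing outside `W` and
`z, z'` vanishing on `W`, `S_{x⊕z, b⊕z'} = [z = z'] S_{x,b}`. [cite: KempeEtAl2010, Observation 3] -/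
theorem pauliString_merge_merge {W : Finset ι} {S : ι → Pauli} (hS : S ∈ stringsOn W)
    {x b z z' : ι → Bool} (hx : ∀ i, i ∉ W → x i = false) (hb : ∀ i, i ∉ W → b i = false)
    (hz : ∀ i, i ∈ W → z i = false) (hz' : ∀ i, i ∈ W → z' i = false) :
    pauliString S (fun i => if i ∈ W then x i else z i) (fun i => if i ∈ W then b i else z' i) =
      if z = z' then pauliString S x b else 0 := by
  simp only [pauliString_eq, tensorAll_apply]
  have key : ∀ i, (S i).mat (if i ∈ W then x i else z i) (if i ∈ W then b i else z' i) =
      (S i).mat (x i) (b i) * (if i ∈ W ∨ z i = z' i then 1 else 0) := by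
    intro i
    by_cases h : i ∈ W
    · simp [h]
    · rw [mem_stringsOn.1 hS i h, hx i h, hb i h]
      by_cases hzz : z i = z' i <;> simp [h, hzz]
  simp only [key, Finset.prod_mul_distrib, Finset.prod_boole, Finset.mem_univ, true_implies]
  by_cases h : z = z'
  · subst h
    rw [if_pos fun i => Or.inr rfl, if_pos rfl, mul_one]
  · rw [if_neg h, if_neg, mul_zero]
    intro h'
    apply h
    funext i
    by_cases hi : i ∈ W
    · rw [hz i hi, hz' i hi]
    · exact (h' i).resolve_left hi

/-- **Observation 3** (tracing out qubits): for a string `S` supported in `W`,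
`Tr(S M) = Tr(S M_W)` with `M_W = reduceTo W M` the embedded partial trace.
[cite: KempeEtAl2010, Observation 3] -/
theorem pauliCoeff_reduceTo {W : Finset ι} {S : ι → Pauli} (hS : S ∈ stringsOn W)
    (M : Matrix (ι → Bool) (ι → Bool) ℂ) : pauliCoeff (reduceTo W M) S = pauliCoeff M S := by
  -- both sides as the same triple sum
  have hR : pauliCoeff (reduceTo W M) S = ∑ x : ι → Bool, ∑ b : ι → Bool, ∑ z : ι → Bool,
      (if (∀ i, i ∉ W → x i = false) ∧ (∀ i, i ∉ W → b i = false) ∧ (∀ i, i ∈ W → z i = false) then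
        pauliString S x b * M (fun i => if i ∈ W then b i else z i) (fun i => if i ∈ W then x i else z i)
        else 0) := by
    rw [pauliCoeff_eq, Matrix.trace]
    simp only [Matrix.diag_apply, Matrix.mul_apply, reduceTo_apply, Finset.mul_sum]
    refine Finset.sum_congr rfl fun x _ => Finset.sum_congr rfl fun b _ => Finset.sum_congr rfl fun z _ => ?_
    by_cases h : (∀ i, i ∉ W → b i = false) ∧ (∀ i, i ∉ W → x i = false) ∧ (∀ i, i ∈ W → z i = false)
    · rw [if_pos h, if_pos ⟨h.2.1, h.1, h.2.2⟩]
    · rw [if_neg h, if_neg (fun h' => h ⟨h'.2.1, h'.1, h'.2.2⟩), mul_zero]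
  have hM : pauliCoeff M S = ∑ y : ι → Bool, ∑ a : ι → Bool, pauliString S y a * M a y := by
    rw [pauliCoeff_eq, Matrix.trace]
    simp only [Matrix.diag_apply, Matrix.mul_apply]
  rw [hR, hM, ← sum_split W (fun y => ∑ a : ι → Bool, pauliString S y a * M a y)]
  refine Finset.sum_congr rfl fun x _ => ?_
  rw [Finset.sum_comm]
  refine Finset.sum_congr rfl fun z _ => ?_
  by_cases hxz : (∀ i, i ∉ W → x i = false) ∧ (∀ i, i ∈ W → z i = false)
  · rw [if_pos hxz, ← sum_split W (fun a => pauliString S (fun i => if i ∈ W then x i else z i) a *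
      M a (fun i => if i ∈ W then x i else z i))]
    refine Finset.sum_congr rfl fun b _ => ?_
    by_cases hb : (∀ i, i ∉ W → b i = false)
    · rw [if_pos ⟨hxz.1, hb, hxz.2⟩, Finset.sum_eq_single z]
      · rw [if_pos ⟨hb, hxz.2⟩, pauliString_merge_merge hS hxz.1 hb hxz.2 hxz.2, if_pos rfl]
      · intro z' _ hz'
        by_cases hz'Z : (∀ i, i ∈ W → z' i = false)
        · rw [if_pos ⟨hb, hz'Z⟩, pauliString_merge_merge hS hxz.1 hb hxz.2 hz'Z, if_neg (Ne.symm hz'),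
            zero_mul]
        · rw [if_neg (fun h => hz'Z h.2)]
      · exact fun h => absurd (Finset.mem_univ _) h
    · rw [if_neg (fun h => hb h.2.1)]
      exact (Finset.sum_eq_zero fun z' _ => if_neg fun h => hb h.1).symm
  · rw [if_neg hxz]
    exact Finset.sum_eq_zero fun b _ => if_neg fun h => hxz ⟨h.1, h.2.2⟩

/-! ### Block Parseval and the Hilbert–Schmidt expression of the weight -/

/-- The completeness kernel restricted to strings on `W`, on the block of labels vanishing
outside `W`: `Σ_{S ∈ 𝒫^W} S_{xy} conj(S_{x'y'}) = 2^{|W|} [x = x'] [y = y']`.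
[cite: KempeEtAl2010, §2 (𝒫ⁿ is an orthogonal basis) and Observation 3] -/
theorem sum_stringsOn_apply_mul_star_apply {W : Finset ι} {x y x' y' : ι → Bool}
    (hx : ∀ i, i ∉ W → x i = false) (hy : ∀ i, i ∉ W → y i = false)
    (hx' : ∀ i, i ∉ W → x' i = false) (hy' : ∀ i, i ∉ W → y' i = false) :
    ∑ S ∈ stringsOn W, pauliString S x y * star (pauliString S x' y') =
      if x = x' ∧ y = y' then (2 : ℂ) ^ W.card else 0 := by
  have hstar : ∀ S : ι → Pauli, star (pauliString S x' y') = pauliString S y' x' := fun S => by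
    have := congrFun (congrFun (conjTranspose_pauliString S) y') x'
    rwa [Matrix.conjTranspose_apply] at this
  simp only [hstar]
  simp only [pauliString_eq, tensorAll_apply, ← Finset.prod_mul_distrib, stringsOn]
  rw [← Finset.prod_univ_sum (fun i => if i ∈ W then Finset.univ else {Pauli.I})
    (fun i Q => Pauli.mat Q (x i) (y i) * Pauli.mat Q (y' i) (x' i))]
  have key : ∀ i, (∑ Q ∈ (if i ∈ W then Finset.univ else {Pauli.I}),
      Pauli.mat Q (x i) (y i) * Pauli.mat Q (y' i) (x' i)) =
      if x i = x' i ∧ y i = y' i then (if i ∈ W then 2 else 1) else 0 := by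
    intro i
    by_cases hi : i ∈ W
    · simp only [hi, if_true, Pauli.sum_mat_mul_mat]
    · simp [hi, hx i hi, hy i hi, hx' i hi, hy' i hi]
  simp only [key, Finset.prod_ite_zero, Finset.mem_univ, true_implies]
  have hprod : (∏ i : ι, (if i ∈ W then (2 : ℂ) else 1)) = 2 ^ W.card := by
    rw [Finset.prod_ite, Finset.prod_const_one, mul_one, Finset.prod_const]
    congr 1
    simp
  rw [hprod]
  by_cases h : x = x' ∧ y = y'
  · rw [if_pos h, if_pos fun i => ⟨congrFun h.1 i, congrFun h.2 i⟩]
  · rw [if_neg h, if_neg]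
    intro h'
    exact h ⟨funext fun i => (h' i).1, funext fun i => (h' i).2⟩

/-- **Block Parseval**: for a matrix `N` supported on the block of labels vanishing outside `W`,
`Σ_{S ∈ 𝒫^W} |Tr(S N)|² = 2^{|W|} Σ_{x,y} |N x y|²`. [cite: KempeEtAl2010, §2 (Parseval) and Lemma 7 ("or equivalently")] -/
theorem sum_stringsOn_norm_pauliCoeff_sq {W : Finset ι} (N : Matrix (ι → Bool) (ι → Bool) ℂ)
    (hN : ∀ x y, ¬ ((∀ i, i ∉ W → x i = false) ∧ (∀ i, i ∉ W → y i = false)) → N x y = 0) :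
    ∑ S ∈ stringsOn W, ‖pauliCoeff N S‖ ^ 2 = (2 : ℝ) ^ W.card * ∑ x, ∑ y, ‖N x y‖ ^ 2 := by
  classical
  have hc : ∀ S : ι → Pauli, pauliCoeff N S =
      ∑ p : (ι → Bool) × (ι → Bool), pauliString S p.1 p.2 * N p.2 p.1 := by
    intro S
    rw [pauliCoeff_eq, Matrix.trace, Fintype.sum_prod_type]
    simp only [Matrix.diag_apply, Matrix.mul_apply]
  have inner : ∀ p q : (ι → Bool) × (ι → Bool),
      ∑ S ∈ stringsOn W, pauliString S p.1 p.2 * N p.2 p.1 *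
        ((starRingEnd ℂ) (pauliString S q.1 q.2) * (starRingEnd ℂ) (N q.2 q.1)) =
      if p = q then (2 : ℂ) ^ W.card * (N p.2 p.1 * (starRingEnd ℂ) (N p.2 p.1)) else 0 := by
    intro p q
    have : ∀ S : ι → Pauli, pauliString S p.1 p.2 * N p.2 p.1 *
        ((starRingEnd ℂ) (pauliString S q.1 q.2) * (starRingEnd ℂ) (N q.2 q.1)) =
        (N p.2 p.1 * (starRingEnd ℂ) (N q.2 q.1)) *
          (pauliString S p.1 p.2 * star (pauliString S q.1 q.2)) := by
      intro S; rw [Complex.star_def]; ring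
    simp only [this, ← Finset.mul_sum]
    by_cases hp : (∀ i, i ∉ W → p.1 i = false) ∧ (∀ i, i ∉ W → p.2 i = false)
    · by_cases hq : (∀ i, i ∉ W → q.1 i = false) ∧ (∀ i, i ∉ W → q.2 i = false)
      · rw [sum_stringsOn_apply_mul_star_apply hp.1 hp.2 hq.1 hq.2]
        by_cases h : p = q
        · subst h; simp only [and_self, if_true]; ring
        · rw [if_neg h, if_neg, mul_zero]
          exact fun h' => h (Prod.ext h'.1 h'.2)
      · have hq0 : N q.2 q.1 = 0 := hN _ _ fun h => hq ⟨h.2, h.1⟩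
        rw [hq0, map_zero, mul_zero, zero_mul]
        by_cases h : p = q
        · subst h; exact absurd hp hq
        · rw [if_neg h]
    · have hp0 : N p.2 p.1 = 0 := hN _ _ fun h => hp ⟨h.2, h.1⟩
      rw [hp0, zero_mul, zero_mul]
      split_ifs <;> simp
  set t : (ι → Pauli) → (ι → Bool) × (ι → Bool) → (ι → Bool) × (ι → Bool) → ℂ := fun S p q =>
    pauliString S p.1 p.2 * N p.2 p.1 *
      ((starRingEnd ℂ) (pauliString S q.1 q.2) * (starRingEnd ℂ) (N q.2 q.1)) with ht
  have h1 : ∀ S : ι → Pauli, pauliCoeff N S * (starRingEnd ℂ) (pauliCoeff N S) = ∑ p, ∑ q, t S p q := by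
    intro S
    rw [hc, map_sum, Finset.sum_mul_sum]
    refine Finset.sum_congr rfl fun p _ => Finset.sum_congr rfl fun q _ => ?_
    rw [ht, map_mul]
  have h2 : ∑ S ∈ stringsOn W, ∑ p, ∑ q, t S p q =
      ∑ p : (ι → Bool) × (ι → Bool), ∑ q : (ι → Bool) × (ι → Bool), ∑ S ∈ stringsOn W, t S p q :=
    Finset.sum_comm.trans (Finset.sum_congr rfl fun p _ => Finset.sum_comm)
  apply Complex.ofReal_injective
  push_cast
  simp only [← Complex.mul_conj', h1]
  rw [h2]
  simp only [ht, inner, Finset.sum_ite_eq, Finset.mem_univ, if_true, ← Finset.mul_sum]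
  congr 1
  rw [Fintype.sum_prod_type, Finset.sum_comm]

/-- **The Pauli weight through the partial trace**: `Σ_{S ∈ 𝒫^W} |Tr(S M)|² = 2^{|W|} ‖M_W‖²_{HS}`
(Observation 3 followed by Parseval on the block; the identity behind "or equivalently
`Tr(δ_V²) ≤ 2 θ^{dist V}`" in Lemma 7). [cite: KempeEtAl2010, Lemma 7 and Observation 3] -/
theorem pauliWeight_eq_card_pow_mul_norm_reduceTo (M : Matrix (ι → Bool) (ι → Bool) ℂ) (W : Finset ι) :
    pauliWeight M W = (2 : ℝ) ^ W.card * ∑ x, ∑ y, ‖reduceTo W M x y‖ ^ 2 := by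
  rw [← sum_stringsOn_norm_pauliCoeff_sq (reduceTo W M) (fun x y h => reduceTo_apply_of_not W M h),
    pauliWeight_eq]
  exact Finset.sum_congr rfl fun S hS => by rw [pauliCoeff_reduceTo hS]

/-! ### The base case of Lemma 7 -/

/-- The Hilbert–Schmidt norm as a trace. [folklore] -/
theorem sum_norm_sq_eq_re_trace {m : Type*} [Fintype m] (N : Matrix m m ℂ) :
    ∑ x, ∑ y, ‖N x y‖ ^ 2 = (N * Nᴴ).trace.re := by
  have : ((∑ x, ∑ y, ‖N x y‖ ^ 2 : ℝ) : ℂ) = (N * Nᴴ).trace := by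
    simp [Matrix.trace, Matrix.mul_apply, Complex.mul_conj']
  rw [← this, Complex.ofReal_re]

/-- **Base case of Lemma 7** (§3.1.1): for density matrices `ρ, τ` (positive semidefinite, trace
one) and every wire set `W`, `Σ_{S ∈ 𝒫^W} |Tr(S(ρ − τ))|² ≤ 2 · 2^{|W|}`, i.e.
`Tr(δ_W²) = Tr ρ_W² + Tr τ_W² − 2 Tr(ρ_W τ_W) ≤ 2`. [cite: KempeEtAl2010, §3.1.1 (Base case)] -/
theorem pauliWeight_sub_le_of_density {ρ τ : Matrix (ι → Bool) (ι → Bool) ℂ} (hρ : ρ.PosSemidef)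
    (hρ1 : ρ.trace = 1) (hτ : τ.PosSemidef) (hτ1 : τ.trace = 1) (W : Finset ι) :
    pauliWeight (ρ - τ) W ≤ 2 * 2 ^ W.card := by
  rw [pauliWeight_eq_card_pow_mul_norm_reduceTo, sum_norm_sq_eq_re_trace, reduceTo_sub]
  have hρ' := posSemidef_reduceTo W hρ
  have hτ' := posSemidef_reduceTo W hτ
  have hherm : (reduceTo W ρ - reduceTo W τ)ᴴ = reduceTo W ρ - reduceTo W τ := by
    rw [conjTranspose_sub, hρ'.1, hτ'.1]
  rw [hherm]
  have h := Literature.LinearAlgebra.Matrix.re_trace_sub_mul_sub_le_of_posSemidef hρ' hτ'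
  rw [trace_reduceTo, trace_reduceTo, hρ1, hτ1, Complex.one_re, one_pow] at h
  have h2 : (0 : ℝ) ≤ 2 ^ W.card := by positivity
  nlinarith

end Literature.Computability.QuantumComplexity
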